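import Mathlib
import Summits.Ventures.FusionMHD.Models.CerfonFreidbergIterLikeQHalfResDefs
import HarnessLib

/-!
# Ventures/FusionMHD — Models/CerfonFreidbergIterLikeQHalfResPanels2.lean: KERNEL CHECK of the resistive-register certificates of panel(s) 1 (of 32)
# at `ψ_N = 1/2` of THE Cerfon–Freidberg ITER-like instance

HONEST FRAMING (LADDER-GRIDFUSION three columns; CF rung; rider «D_R at ψ_N = 1/2»).  One `decide +kernel` (≈ 60–90 s): for each listed panel the obligation
`CFIterLike.QHalfRes.ResCert.ok` (`Models/CerfonFreidbergIterLikeQHalfResDefs.lean`) — the Taylor-model run of `progR = progM ++ block3R` over ★ #117's parameter box is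
ACCEPTED and the kernel's two panel-integral enclosures (`g_AG`, `g_W` along the approximant) lie inside the claimed integers (compiled `#eval` of the same functions, slack
one unit of `2⁻⁶⁰`; float truth inside every panel, `genqm/truthR.json`).  MODELLED: analytic Cerfon–Freidberg family; nothing about a device or stability.
No `native_decide`.  Typer/prover: gridfusion-model-7 (g7), 2026-08-28.  Citations: Zheng 2015 §3.2 (3.42) [Zheng2015];
Mahboubi–Melquiond–Sibut-Pinote 2016 §3.2 Lemma 3 [MahboubiMelquiondSibutpinote2016].
-/

namespace Summit.Ventures.FusionMHD.Models.CFIterLike.QHalfRes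

/-- Resistive-register certificate data of panel(s) 1. [instance data] -/
def resCert2 : List ResCert := [
  { j := 1, cand1 := [95941115408989028352, 61921015120728711168, 685209230057787228160, 535893126104702582784, 3089244632611704274944, 3040003000504731828224, 12277496457252078354432, 11801908151226877345792, 2434351252765965025280, 7349826291278836567900160, 169661101115679995668201472, -9254086214289254499873718272, -262072683486954066977860091904],
    cand2 := [118714109347717496832, 44387063580984197120, 490529712164639145984, 370469288523856543744, 2147466412707588341760, 2259634614156463177728, 9165758932403312656384, 8819317853485085491200, 1383597059771228749824, 7529164997439053488979968, 207220388928588515685433344, -10354943417834675026152914944, -374096281700198224876625985536],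
    deg := 12, e1 := 41, e2 := 41, glo := 3640430591262042, ghi := 3640430859470875, wlo := 142964652572507031, whi := 142964661653598992 }]

/-- **KERNEL CHECK** of the two resistive registers on panel(s) 1. -/
theorem resCert2_ok : CFIterLike.QHalfRes.resCert2.all ResCert.ok = true := by
  decide +kernel

end Summit.Ventures.FusionMHD.Models.CFIterLike.QHalfRes
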